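import Summits.FinalStateConjecture.FinalStateConjecture.Theorems.PhaseMixingCaptureBulkKerrCaptureC2OfClaim
import Literature.Geometry.Lorentzian.KerrStabilitySubextremalCauchy
import Literature.Geometry.Lorentzian.KerrDataProofs
import Literature.Geometry.Lorentzian.KerrSchildCoord
import Literature.Geometry.Lorentzian.KerrSliceFacts
import HarnessLib

/-!
# `BulkKerrCaptureC2` modulo the all-orders Hintz claim, BY NAME (line `all-orders-lebesgue-port`)

Crux `stmt-FinalStateConjecture-14985`
(`Summit.FinalStateConjecture.FinalStateConjecture.Theses.PhaseMixingCapture.BulkKerrCaptureC2`), line lead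
`prover-line-stmt-FinalStateConjecture-14985-0`, line `SketchStandalone` (idea `all-orders-lebesgue-port`),
skeleton `Cruxes/BulkKerrCaptureC2/Lines/SketchStandalone.lean` v2.

`Theorems/PhaseMixingCaptureBulkKerrCaptureC2OfClaim.lean` (p96721) proves the port with the claim's BODY
as hypothesis (the farm's olean of `KerrStabilitySubextremalCauchy` predated the re-vendoring p88775 when
it landed). This file restates the same implications with the Literature claim
`Literature.Geometry.Lorentzian.hintz_kerr_stability_subextremal_cauchy_allOrders` BY NAME — the named
`def` unfolds to that body definitionally, so every proof is a one-line application: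

* `stub_c2Far_of_allOrdersClaim` — registered stub of skeleton v2: the claim (at all instances of the
  two `Prop`-classes) implies the far form of the crux;
* `bulkKerrCaptureC2_of_allOrdersClaim'` — the claim (all instances) implies `BulkKerrCaptureC2`;
* `bulkKerrCaptureC2_of_allOrdersClaim` — the same with the claim taken ONCE, at the tree's witnesses
  of its instance parameters (the three `Kerr.Facts` field theorems / `Kerr.sliceFacts_holds`; proof
  irrelevance), so that the hypothesis is literally the named fact applied to closed terms.

HONEST STATUS. All three are CONDITIONAL on Hintz's unrefereed claim (arXiv:2606.28253v2, Thm. 13.1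
with (13.2), Remarks 13.2–13.3; `@[claim "Hintz2026" "under-review"]`); none closes
stmt-FinalStateConjecture-14985 by itself. The crux closes the day
`hintz_kerr_stability_subextremal_cauchy_allOrders` is discharged (`…_holds`), by
`bulkKerrCaptureC2_of_allOrdersClaim' …_holds` — and by nothing short of it: the crux at `a₁ = |χ₀|`
gives back the claim's `k = 2`, `ρ₀ = 1` instance locally uniformly around every centre `χ₀`
(`Cruxes/BulkKerrCaptureC2/SketchIdeator2.lean`, `bulkKerrCaptureC2_iff_pointwiseOpenCover`).
-/

-- the doubled `FinalStateConjecture.FinalStateConjecture` path component trips dupNamespace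
set_option linter.dupNamespace false

noncomputable section

open Set Filter Topology Function
open scoped Manifold ContDiff ENNReal Topology
open Literature.Geometry.Lorentzian
open Summit.FinalStateConjecture.FinalStateConjecture.Theorems.BulkKerrCapture
open Summit.FinalStateConjecture.FinalStateConjecture.Theses.PhaseMixingCapture (BulkKerrCaptureC2)

namespace Summit.FinalStateConjecture.FinalStateConjecture.Theorems

/-- **Registered stub `stub_c2Far_of_allOrdersClaim` of line `SketchStandalone` (skeleton v2) for crux
`BulkKerrCaptureC2`.** The claim-tagged Literature fact
`hintz_kerr_stability_subextremal_cauchy_allOrders`, BY NAME at all instances of the two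
`Prop`-classes, implies the far form of the crux (right-hand side of
`PhaseMixingCaptureCaptureSuffices.bulkKerrCaptureC2_iff`). One line from the landed body form
`stub_c2Far_of_allOrdersBody` (p96721): the named `def` unfolds to its body. [folklore] -/
theorem stub_c2Far_of_allOrdersClaim :
    (∀ [Kerr.Facts] [Kerr.SliceFacts], hintz_kerr_stability_subextremal_cauchy_allOrders) →
    ∀ [Kerr.Facts] [Kerr.SliceFacts], ∀ a₁ : ℝ, a₁ < 1 → ∃ (s : ℕ) (δ : ℝ),
      ∀ (M : ℝ) (hM : 0 < M), ∀ η > (0 : ℝ), ∃ ε > (0 : ℝ), ∀ a : ℝ, |a| ≤ a₁ * M →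
        ∀ (D : InitialDataSet 𝓘(ℝ, E3) (Kerr.slice a M)) [D.metric.HasLeviCivita],
          D.IsVacuumConstraintSolution →
          (∀ s' : ℕ,
            InitialDataSet.dataWeightedSobolevEDist s' δ D (Kerr.data M a M hM.le) < ⊤) →
          InitialDataSet.dataWeightedSobolevEDist s δ D (Kerr.data M a M hM.le) <
            ENNReal.ofReal ε →
          ∀ 𝒟 : VacuumCauchyDevelopment D, 𝒟.IsMaximal →
            ∃ (M' a' : ℝ) (𝒟oc : Set 𝒟.carrier), Kerr.IsSubextremal M' a' ∧
              𝒟.HasCompleteFutureNullInfinityFar ∧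
              𝒟.toSpacetime.ConvergesToKerr 𝒟oc M' a' 2 ∧ |M' - M| + |a' - a| ≤ η :=
  fun hclaim ↦ stub_c2Far_of_allOrdersBody hclaim

/-- **The crux modulo the named claim (all instances).** HONEST STATUS: CONDITIONAL on
`hintz_kerr_stability_subextremal_cauchy_allOrders` (Hintz 2026, unrefereed); does not close the item by
itself; `bulkKerrCaptureC2_of_allOrdersClaim' …_holds` will. [folklore] -/
theorem bulkKerrCaptureC2_of_allOrdersClaim'
    (hclaim : ∀ [Kerr.Facts] [Kerr.SliceFacts], hintz_kerr_stability_subextremal_cauchy_allOrders) :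
    BulkKerrCaptureC2 :=
  PhaseMixingCaptureCaptureSuffices.bulkKerrCaptureC2_iff.2 (stub_c2Far_of_allOrdersClaim hclaim)

/-- **The crux modulo the named claim taken once, at the canonical instances.** `BulkKerrCaptureC2`
from `hintz_kerr_stability_subextremal_cauchy_allOrders` at the tree's witnesses of its two `Prop`-class
parameters — `Kerr.Facts` from its three field theorems `Kerr.isConnected_region_holds`,
`Kerr.contMDiff_bilin_holds`, `Kerr.contMDiff_timeVector_holds` (as `Theorems.SwallowTheDatum.kerrFacts`),
and `Kerr.sliceFacts_holds` (any two instances of a `Prop`-class agree by proof irrelevance, so this is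
the same hypothesis as the `∀ [..]` form). HONEST STATUS: CONDITIONAL on the unrefereed claim; the item
stays open until that fact is discharged. [folklore] -/
theorem bulkKerrCaptureC2_of_allOrdersClaim
    (hclaim : @hintz_kerr_stability_subextremal_cauchy_allOrders
      ⟨Kerr.isConnected_region_holds, Kerr.contMDiff_bilin_holds, Kerr.contMDiff_timeVector_holds⟩
      Kerr.sliceFacts_holds) :
    BulkKerrCaptureC2 :=
  bulkKerrCaptureC2_of_allOrdersClaim' (by intro _ _; exact hclaim)

end Summit.FinalStateConjecture.FinalStateConjecture.Theorems

end
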